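import Literature.AlgebraicGeometry.HodgeTheory.TypeIIMinimalAlbertPowersHodgeClasses
import Literature.AlgebraicGeometry.HodgeTheory.BettiOneHodgeStructureModelIndependence
import Literature.AlgebraicGeometry.Motives.HodgeLieRealPlacesRank
import HarnessLib

/-!
# `dim Lie Hg(H¹A) = 3e` and `dim MT(H¹A) = 3e + 1` for a simple abelian variety of type II with minimal dimension `dim A = 2e` (Moonen–Zarhin 1999 (2.2) «`Hg = U_{D^opp}`»; Banaszak–Gajda–Krasoń 2006 (7.22) `H(A) = L(A)`; V. K. Murty 1988 Thm. 2, `m = 1`)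

Family `hodge`, layer `Literature/AlgebraicGeometry/HodgeTheory`; THEOREMS ONLY (no definition, no named fact; D-0026).
Research context: cell `pub-hodgecm2` (COR-CM), seat `b27`, count-neutral lane MT-RANK ladder (`CorCM/MumfordTateRank*`): the
input of the rung `t = 3e + 1` for TYPE II MINIMAL, the type-II analogue of the tree's real-multiplication count
`HodgeTheory/RealMultiplicationMumfordTateRank` (`t = 3 dim B + 1`, Ribet).  UNCONDITIONAL; nothing here uses or asserts HC_CM.

SETTING.  `A` a SIMPLE complex abelian variety with a real splitting `Φ : ℝ ⊗_ℚ End⁰(A) ≃ₐ[ℝ] ∏_ι M₂(ℝ)` and `dim A = 2|ι|`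
(Albert type II with `m = 1`: `End⁰(A)` a totally indefinite quaternion algebra over a totally real field `K` of degree
`e = |ι|`, `dim A = 2e`).  The tree's `exists_mem_hodgeLieC_iff_of_realSplitting` (`HodgeTheory/TypeIIMinimalPowersHodgeClasses`,
programme R7 of the cell `pub-hodge-ring2`) describes `Lie Hg(A) ⊗ ℂ` in glued Hodge-adapted bases `b'` of the `2|ι|` matrix-unit
blocks `W_{(i,j)} = u(i)_{jj} H¹_ℂ`: block-preserving, trace-free blocks, EQUAL blocks on each class of an idempotent class map
`cls` on `ι × Fin 2`, and conversely — `Lie Hg(A) ⊗ ℂ = ⊕_{classes} 𝔰𝔩₂(ℂ)`.  The class map is not named there; this file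
IDENTIFIES THE CLASSES and draws the dimension count:

* `fst_eq_of_cls_eq` — two blocks in the same class lie over the SAME factor `i ∈ ι`: otherwise the identity intertwiner
  `W_{k'} → W_k` commutes with `Lie Hg ⊗ ℂ`, hence lies in `End_Hdg ⊗ ℂ = span_ℂ {u(i)_{ab}}` (commutant theorem
  `mem_span_endAlg_of_forall_commute`, Riemann `mem_endAlg_hodge_one_iff_exists_bettiRep`, `baseChange_mem_span_unit`), and
  `u(i)_{jj} · (span of units) · u(i')_{j'j'} = 0` for `i ≠ i'` kills it — Hazama's «mutually non-isomorphic `𝔥`-modules».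
* `cls_eq_of_fst_eq` — the two blocks `W_{(i,0)}`, `W_{(i,1)}` over one factor ARE in the same class: the unit `u(i)_{10}` maps
  `W_{(i,0)}` injectively into `W_{(i,1)}` and commutes with `Lie Hg ⊗ ℂ`, so an element of `Lie Hg ⊗ ℂ` vanishing on
  `W_{(i,1)}` vanishes on `W_{(i,0)}`; with different classes the converse direction of the `iff` would produce an element
  with block `N ≠ 0` at `(i,0)` and `0` at `(i,1)` — Moonen–Zarhin's «`V_ℂ = W ⊗ ℂ²`», Abdulali's «two copies of the standard
  representation».
* **`finrank_hodgeLieC_hodge_one_of_isSimple_realSplitting`**, **`finrank_hodgeLie_hodge_one_of_isSimple_realSplitting`** —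
  hence the classes are the `|ι|` pairs `{(i,0),(i,1)}` and `Y ↦ (blockMat Y (i,0))_i` is a linear bijection of `Lie Hg ⊗ ℂ`
  onto the trace-free families indexed by `ι`: `dim_ℂ Lie Hg(A) ⊗ ℂ = dim_ℚ Lie Hg(A) = 3|ι|` (Hazama's «`𝔥 = 𝔰𝔩₂ × ⋯ × 𝔰𝔩₂`»,
  B–G–K's `H(A) = L(A) = C_D(Sp)` of dimension `3e`).
* **`mtRank_hodge_one_of_isSimple_realSplitting`** — `dim MT(H¹A) = 3|ι| + 1` (the tree's `dim MT = dim Lie Hg + 1`).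
* **`finrank_hodgeLie_hodge_one_of_isSimple_isTotallyIndefinite`**, **`mtRank_hodge_one_of_isSimple_isTotallyIndefinite`**,
  **`mtRank_hodge_one_of_isSimple_isTotallyIndefinite'`** — the ALBERT form: `End⁰(A)` a quaternion algebra over a totally real
  number field `K`, split at every infinite place, `dim A = 2[K:ℚ]` ⟹ `dim Lie Hg(H¹A) = 3[K:ℚ]`, `dim MT(H¹A) = 3[K:ℚ] + 1`
  (real splitting indexed by the `[K:ℚ]` infinite places, `nonempty_realSplitting_of_isSimple_isTotallyIndefinite`); the primed
  form takes an arbitrary smooth-projective witness and the tree's model `exists_isReal_hodgeModel_holds` (the form used on the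
  ladder `CorCM/MumfordTateRank*`).

So QM abelian surfaces (`e = 1`) sit on the rung `t = 4`, type II(2) fourfolds on `t = 7`, type II(3) sixfolds on `t = 10`.

## References

* [MoonenZarhin1999LowDim] B. Moonen, Yu. G. Zarhin, *Hodge classes on abelian varieties of low dimension*, Math. Ann. 315
  (1999) 711–733, (2.2) Type 2(1) («`Hg(X) = U_{D^opp}`», `V_ℂ = W ⊗ ℂ²`), §3 (3.1). [cite: MoonenZarhin1999LowDim, (2.2) and §3 (3.1)]
* [BanaszakGajdaKrason2006] G. Banaszak, W. Gajda, P. Krasoń, Doc. Math. Extra Vol. Coates (2006) 35–75, p. 36 (type II),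
  Cor. 7.19 (7.22) («`H(A) = L(A) = C_D(Sp(V, ψ))`»), Thm. 7.34. [cite: BanaszakGajdaKrason2006, p. 36, (7.22) and Thm. 7.34]
* [Murty1988] V. Kumar Murty, *The Hodge group of an abelian variety*, Proc. AMS 104 (1988) 61–68, Thm. 2 (p. 67)
  («`Hod(A) = L(A)`», `m = 1`). [cite: Murty1988, Thm. 2 (p. 67)]
* [Hazama1983] F. Hazama, Tôhoku Math. J. 35 (1983) 303–308, §3 pp. 305–306 («`𝔥 = 𝔰𝔩₂ × ⋯ × 𝔰𝔩₂` where the i-th component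
  acts on `V_i ⊕ ⋯ ⊕ V_i` diagonally»; «mutually non-isomorphic `𝔥`-modules»). [cite: Hazama1983, §3 (pp. 305–306)]
* [Abdulali2016TateTwists] S. Abdulali, in LMS LN 427 (2016), §2.4 (type II: two copies of the standard representation).
  [cite: Abdulali2016TateTwists, §2.4]
* [MumfordAV1970] D. Mumford, *Abelian Varieties* (1970), §21 Thm. 2 (type II: `D ⊗_ℚ ℝ ≅ M₂(ℝ) × ⋯ × M₂(ℝ)`).
  [cite: MumfordAV1970, §21 Thm. 2 (type II)]
-/

noncomputable section

open scoped TensorProduct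
open CategoryTheory Module NumberField

namespace Literature.AlgebraicGeometry.HodgeTheory

open Literature.AlgebraicGeometry.Motives
open Literature.AlgebraicGeometry.Motives.HodgeStructure
open Literature.AlgebraicGeometry.ComplexMultiplication
open Literature.RepresentationTheory.GeneralLinear
open Literature.RingTheory.CentralSimple
open Literature.NumberTheory.Automorphic (IsQuaternionAlgebra)

variable {A : AbelianVariety ℂ} {ι : Type} [Fintype ι] [DecidableEq ι]

/-! ### §1 The classes of the glued description are the pairs `{(i,0), (i,1)}` -/

section Classes

variable [HodgeTensorFacts.{0, 0}] (Φ : ℝ ⊗[ℚ] A.endAlgebra ≃ₐ[ℝ] (ι → Matrix (Fin 2) (Fin 2) ℝ))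
  {cls : ι × Fin 2 → ι × Fin 2} {b' : ∀ k : ι × Fin 2, Module.Basis (Fin 2) ℂ (RealSplitting.block (bettiRep A) Φ k)}

/-- Every `Y ∈ Lie Hg(A) ⊗ ℂ` commutes with every `ρ_ℝ y`, `y ∈ ℝ ⊗ End⁰(A)` (`ρ_ℝ (r ⊗ z) = r · (z^*)_ℂ` and `z^*` is a
Hodge endomorphism of `H¹`). [cite: MoonenZarhin1999LowDim, (2.2) and §3 (3.1)] -/
theorem commute_rep_of_mem_hodgeLieC (hHD : exists_isReal_hodgeModel) (hI : hodgePQ_independent_of_hodgeModel)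
    {Y : Module.End ℂ (ℂ ⊗[ℚ] bettiCohomology A.X 1)}
    (hY : Y ∈ (BettiUniverse.hodge hHD (AbelianVariety.isSmoothProjective_holds (A := A)) 1).hodgeLieC)
    (y : ℝ ⊗[ℚ] A.endAlgebra) :
    Y * RealSplitting.rep (bettiRep A) y = RealSplitting.rep (bettiRep A) y * Y := by
  induction y using TensorProduct.induction_on with
  | zero => rw [map_zero, mul_zero, zero_mul]
  | tmul r z =>
    rw [RealSplitting.rep_tmul, mul_smul_comm, smul_mul_assoc]
    congr 1
    exact commute_baseChange_of_mem_hodgeLieC _ hY ⟨_, unop_bettiRep_mem_endAlg hHD hI z⟩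
  | add y y' hy hy' => rw [map_add, mul_add, add_mul, hy, hy']

omit [Fintype ι] in
/-- Every `Y ∈ Lie Hg(A) ⊗ ℂ` commutes with every unit `u(i)_{jk}` of the real splitting.
[cite: MoonenZarhin1999LowDim, (2.2)] [cite: BanaszakGajdaKrason2006, p. 36] -/
theorem commute_unit_of_mem_hodgeLieC (hHD : exists_isReal_hodgeModel) (hI : hodgePQ_independent_of_hodgeModel)
    {Y : Module.End ℂ (ℂ ⊗[ℚ] bettiCohomology A.X 1)}
    (hY : Y ∈ (BettiUniverse.hodge hHD (AbelianVariety.isSmoothProjective_holds (A := A)) 1).hodgeLieC)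
    (i : ι) (j k : Fin 2) :
    Y * RealSplitting.unit (bettiRep A) Φ i j k = RealSplitting.unit (bettiRep A) Φ i j k * Y :=
  commute_rep_of_mem_hodgeLieC hHD hI hY _

omit [Fintype ι] [HodgeTensorFacts.{0, 0}] in
/-- `P_p · y · P_q = 0` for `y` in the span of the units when `p`, `q` lie over DIFFERENT factors of `∏ M₂(ℝ)`
(`u(i)_{jj} u(i'')_{ab} u(i')_{j'j'} = 0` unless `i = i'' = i'`). [cite: BanaszakGajdaKrason2006, Remark 5.13] -/
theorem diag_mul_mul_diag_eq_zero_of_fst_ne {y : Module.End ℂ (ℂ ⊗[ℚ] bettiCohomology A.X 1)}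
    (hy : y ∈ Submodule.span ℂ (Set.range fun t : ι × Fin 2 × Fin 2 =>
      RealSplitting.unit (bettiRep A) Φ t.1 t.2.1 t.2.2))
    {p q : ι × Fin 2} (hpq : p.1 ≠ q.1) :
    RealSplitting.unit (bettiRep A) Φ p.1 p.2 p.2 * y * RealSplitting.unit (bettiRep A) Φ q.1 q.2 q.2 = 0 := by
  induction hy using Submodule.span_induction with
  | mem y hy =>
    obtain ⟨⟨i', j', k'⟩, rfl⟩ := hy
    dsimp only
    rw [RealSplitting.unit_mul]
    by_cases h1 : p.1 = i' ∧ p.2 = j'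
    · rw [if_pos h1, RealSplitting.unit_mul, if_neg]
      rintro ⟨h2, -⟩
      exact hpq h2
    · rw [if_neg h1, zero_mul]
  | zero => rw [mul_zero, zero_mul]
  | add y y' _ _ hy hy' => rw [mul_add, add_mul, hy, hy', add_zero]
  | smul a y _ hy => rw [mul_smul_comm, smul_mul_assoc, hy, smul_zero]

/-- An operator of `H¹ ⊗ ℂ` commuting with `Lie Hg(A) ⊗ ℂ` lies in the complex span of the units of the real splitting
(commutant theorem `End_{Lie Hg}(H¹_ℂ) = End_Hdg ⊗ ℂ`, Riemann `End_Hdg(H¹) = End⁰(A)`, and `(z^*)_ℂ ∈ span {u(i)_{ab}}`).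
[cite: MoonenZarhin1999LowDim, §3 (3.1)] [cite: BanaszakGajdaKrason2006, p. 36 and Remark 5.13] -/
theorem mem_span_unit_of_forall_commute (hHD : exists_isReal_hodgeModel) (hI : hodgePQ_independent_of_hodgeModel)
    {Z : Module.End ℂ (ℂ ⊗[ℚ] bettiCohomology A.X 1)}
    (hZ : ∀ X ∈ (BettiUniverse.hodge hHD (AbelianVariety.isSmoothProjective_holds (A := A)) 1).hodgeLie,
      Z * X.baseChange ℂ = X.baseChange ℂ * Z) :
    Z ∈ Submodule.span ℂ (Set.range fun t : ι × Fin 2 × Fin 2 => RealSplitting.unit (bettiRep A) Φ t.1 t.2.1 t.2.2) := by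
  haveI : Module.Finite ℚ (bettiCohomology A.X 1) := finite_bettiCohomology_one A
  have h := mem_span_endAlg_of_forall_commute _ hZ
  refine (Submodule.span_le.2 ?_) h
  rintro _ ⟨a, ha, rfl⟩
  obtain ⟨z, hz⟩ := (mem_endAlg_hodge_one_iff_exists_bettiRep hHD hI a).1 ha
  rw [← hz]
  exact RealSplitting.baseChange_mem_span_unit (bettiRep A) Φ z

/-- **Blocks in one class lie over the same factor** (Hazama 1983 §3: the `𝔥`-modules over different factors are «mutually
non-isomorphic»; Moonen–Zarhin Lemma (3.4)).  If every `Y ∈ Lie Hg(A) ⊗ ℂ` has equal blocks at `k` and `k'` (in the glued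
bases), then `k.1 = k'.1`: the identity intertwiner `W_{k'} → W_k` commutes with `Lie Hg ⊗ ℂ`, lies in the span of the units,
and is killed by `P_k · _ · P_{k'}` when `k.1 ≠ k'.1`, whereas it sends `b'_{k'} 0 ↦ b'_k 0 ≠ 0`.
[cite: Hazama1983, §3 (pp. 305–306)] [cite: MoonenZarhin1999LowDim, §3 (3.1)] -/
theorem fst_eq_of_cls_eq (hHD : exists_isReal_hodgeModel) (hI : hodgePQ_independent_of_hodgeModel)
    (hiff : ∀ Y : Module.End ℂ (ℂ ⊗[ℚ] bettiCohomology A.X 1),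
      Y ∈ (BettiUniverse.hodge hHD (AbelianVariety.isSmoothProjective_holds (A := A)) 1).hodgeLieC ↔
        (∀ k, Set.MapsTo Y (RealSplitting.block (bettiRep A) Φ k) (RealSplitting.block (bettiRep A) Φ k)) ∧
        (∀ k, (RealPlaces.blockMat (RealSplitting.isInternal_block (bettiRep A) Φ) b' Y k).trace = 0) ∧
        (∀ k k', cls k = cls k' → RealPlaces.blockMat (RealSplitting.isInternal_block (bettiRep A) Φ) b' Y k =
          RealPlaces.blockMat (RealSplitting.isInternal_block (bettiRep A) Φ) b' Y k'))
    {k k' : ι × Fin 2} (hkk' : cls k = cls k') : k.1 = k'.1 := by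
  by_contra hne
  set H := BettiUniverse.hodge hHD (AbelianVariety.isSmoothProjective_holds (A := A)) 1 with hH
  set hint := RealSplitting.isInternal_block (bettiRep A) Φ with hhint
  set Z := RealPlaces.intertwiner hint b' k k' (1 : Matrix (Fin 2) (Fin 2) ℂ) with hZ
  -- `Z` commutes with `Lie Hg ⊗ ℂ`
  have hcomm : ∀ X ∈ H.hodgeLie, Z * X.baseChange ℂ = X.baseChange ℂ * Z := by
    intro X hX
    obtain ⟨hT, -, hcls⟩ := (hiff _).1 (H.baseChange_mem_hodgeLieC hX)
    exact RealPlaces.intertwiner_comm hint b' k k' 1 hT (by rw [mul_one, one_mul, hcls k k' hkk'])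
  have hspan := mem_span_unit_of_forall_commute Φ hHD hI hcomm
  have hzero := diag_mul_mul_diag_eq_zero_of_fst_ne Φ hspan (p := k) (q := k') hne
  -- evaluate at `b' k' 0`
  have hx : (b' k' 0 : ℂ ⊗[ℚ] bettiCohomology A.X 1) ∈ RealSplitting.block (bettiRep A) Φ k' := (b' k' 0).2
  have hPx : RealSplitting.unit (bettiRep A) Φ k'.1 k'.2 k'.2 (b' k' 0 : ℂ ⊗[ℚ] bettiCohomology A.X 1) = b' k' 0 :=
    MatrixUnits.diag_apply_of_mem_range_same (RealSplitting.unit_mul (bettiRep A) Φ) k' hx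
  have hZx : Z (b' k' 0 : ℂ ⊗[ℚ] bettiCohomology A.X 1) = b' k 0 := by
    rw [hZ, RealPlaces.intertwiner_apply_same, Fin.sum_univ_two, Matrix.one_apply_eq, one_smul,
      Matrix.one_apply_ne (by decide), zero_smul, add_zero]
  have hy : (b' k 0 : ℂ ⊗[ℚ] bettiCohomology A.X 1) ∈ RealSplitting.block (bettiRep A) Φ k := (b' k 0).2
  have hPy : RealSplitting.unit (bettiRep A) Φ k.1 k.2 k.2 (b' k 0 : ℂ ⊗[ℚ] bettiCohomology A.X 1) = b' k 0 :=
    MatrixUnits.diag_apply_of_mem_range_same (RealSplitting.unit_mul (bettiRep A) Φ) k hy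
  have h0 : (b' k 0 : ℂ ⊗[ℚ] bettiCohomology A.X 1) = 0 := by
    have h := congrArg (fun T : Module.End ℂ (ℂ ⊗[ℚ] bettiCohomology A.X 1) =>
      T (b' k' 0 : ℂ ⊗[ℚ] bettiCohomology A.X 1)) hzero
    simp only [Module.End.mul_apply, LinearMap.zero_apply] at h
    rw [hPx, hZx, hPy] at h
    exact h
  exact (b' k).ne_zero 0 (Subtype.ext h0)

/-- **The two blocks over one factor are in the same class** (Moonen–Zarhin (2.2) «`V_ℂ = W ⊗ ℂ²`»: the unit `u(i)_{10}` is an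
isomorphism `W_{(i,0)} ⥲ W_{(i,1)}` commuting with `Lie Hg ⊗ ℂ`).  With `cls (i,0) ≠ cls (i,1)` the `iff` would put into
`Lie Hg ⊗ ℂ` the operator with block `N = E₀₁ ≠ 0` on the class of `(i,0)` and `0` elsewhere, which vanishes on `W_{(i,1)}`,
hence — transported by `u(i)_{10}`, inverted on `W_{(i,0)}` by `u(i)_{01}` — on `W_{(i,0)}`: contradiction.
[cite: MoonenZarhin1999LowDim, (2.2)] [cite: Abdulali2016TateTwists, §2.4] -/
theorem cls_eq_of_fst_eq (hHD : exists_isReal_hodgeModel) (hI : hodgePQ_independent_of_hodgeModel)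
    (hiff : ∀ Y : Module.End ℂ (ℂ ⊗[ℚ] bettiCohomology A.X 1),
      Y ∈ (BettiUniverse.hodge hHD (AbelianVariety.isSmoothProjective_holds (A := A)) 1).hodgeLieC ↔
        (∀ k, Set.MapsTo Y (RealSplitting.block (bettiRep A) Φ k) (RealSplitting.block (bettiRep A) Φ k)) ∧
        (∀ k, (RealPlaces.blockMat (RealSplitting.isInternal_block (bettiRep A) Φ) b' Y k).trace = 0) ∧
        (∀ k k', cls k = cls k' → RealPlaces.blockMat (RealSplitting.isInternal_block (bettiRep A) Φ) b' Y k =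
          RealPlaces.blockMat (RealSplitting.isInternal_block (bettiRep A) Φ) b' Y k'))
    (i : ι) : cls (i, 0) = cls (i, 1) := by
  by_contra hne
  set H := BettiUniverse.hodge hHD (AbelianVariety.isSmoothProjective_holds (A := A)) 1 with hH
  set hint := RealSplitting.isInternal_block (bettiRep A) Φ with hhint
  set N : Matrix (Fin 2) (Fin 2) ℂ := Matrix.single 0 1 1 with hN
  set F : ι × Fin 2 → Matrix (Fin 2) (Fin 2) ℂ := fun k => if cls k = cls (i, 0) then N else 0 with hF
  set Y := RealPlaces.assemble hint b' F with hY
  have hYT : ∀ k, Set.MapsTo Y (RealSplitting.block (bettiRep A) Φ k) (RealSplitting.block (bettiRep A) Φ k) :=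
    fun k => RealPlaces.assemble_mapsTo hint b' F k
  have hYF : RealPlaces.blockMat hint b' Y = F := RealPlaces.blockMat_assemble hint b' F
  -- `Y ∈ Lie Hg ⊗ ℂ` by the converse direction of the glued description
  have hYmem : Y ∈ H.hodgeLieC := by
    refine (hiff Y).2 ⟨hYT, fun k => ?_, fun k k' hkk' => ?_⟩
    · rw [hYF, hF]
      dsimp only
      split_ifs
      · rw [hN, Matrix.trace_single_eq_of_ne _ _ _ (by decide)]
      · rw [Matrix.trace_zero]
    · rw [hYF, hF]
      dsimp only
      rw [hkk']
  -- `Y` vanishes on `W_{(i,1)}`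
  have hY1 : ∀ x ∈ RealSplitting.block (bettiRep A) Φ (i, 1), Y x = 0 := by
    refine fun x hx => GluedBlocks.apply_eq_zero_of_blockMat_eq_zero hint b' hYT ?_ hx
    rw [hYF, hF]
    dsimp only
    rw [if_neg (Ne.symm hne)]
  -- hence on `W_{(i,0)}`, through the unit `u(i)_{10}`
  have hu := commute_unit_of_mem_hodgeLieC Φ hHD hI hYmem i 1 0
  have hY0 : ∀ x ∈ RealSplitting.block (bettiRep A) Φ (i, 0), Y x = 0 := by
    intro x hx
    have hux : RealSplitting.unit (bettiRep A) Φ i 1 0 x ∈ RealSplitting.block (bettiRep A) Φ (i, 1) := by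
      have h := RealSplitting.unit_mul (bettiRep A) Φ i 1 1 i 1 0
      rw [if_pos ⟨rfl, rfl⟩] at h
      change _ ∈ LinearMap.range (RealSplitting.unit (bettiRep A) Φ i 1 1)
      rw [← h]
      exact LinearMap.mem_range_self _ _
    have h1 : RealSplitting.unit (bettiRep A) Φ i 1 0 (Y x) = 0 := by
      rw [← Module.End.mul_apply, ← hu, Module.End.mul_apply, hY1 _ hux]
    have hYx : Y x ∈ RealSplitting.block (bettiRep A) Φ (i, 0) := hYT _ hx
    have h2 : RealSplitting.unit (bettiRep A) Φ i 0 0 (Y x) = Y x :=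
      MatrixUnits.diag_apply_of_mem_range_same (RealSplitting.unit_mul (bettiRep A) Φ) (i, 0) hYx
    have h3 := RealSplitting.unit_mul (bettiRep A) Φ i 0 1 i 1 0
    rw [if_pos ⟨rfl, rfl⟩] at h3
    rw [← h2, ← h3, Module.End.mul_apply, h1, map_zero]
  have hF0 : F (i, 0) = 0 := by
    rw [← hYF]
    exact GluedBlocks.blockMat_eq_zero_of_forall_apply hint b' hYT hY0
  have hN0 : N = 0 := by
    rw [hF] at hF0
    dsimp only at hF0
    rwa [if_pos rfl] at hF0
  have h := congrFun (congrFun hN0 0) 1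
  rw [hN, Matrix.single_apply_same, Matrix.zero_apply] at h
  exact one_ne_zero h

/-- **`dim_ℂ Lie Hg(A) ⊗ ℂ = 3|ι|`** from the glued description: `Y ↦ (blockMat Y (i,0))_{i ∈ ι}` is a linear bijection of
`Lie Hg(A) ⊗ ℂ` onto the trace-free families indexed by `ι` (injective: the block at `(i,1)` equals the block at `(i,0)`;
onto: the assembled operator of `k ↦ M_{k.1}` is admissible because classes do not cross factors).
[cite: Hazama1983, §3 (p. 306)] [cite: BanaszakGajdaKrason2006, (7.22)] -/
theorem finrank_hodgeLieC_of_glued (hHD : exists_isReal_hodgeModel) (hI : hodgePQ_independent_of_hodgeModel)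
    (hiff : ∀ Y : Module.End ℂ (ℂ ⊗[ℚ] bettiCohomology A.X 1),
      Y ∈ (BettiUniverse.hodge hHD (AbelianVariety.isSmoothProjective_holds (A := A)) 1).hodgeLieC ↔
        (∀ k, Set.MapsTo Y (RealSplitting.block (bettiRep A) Φ k) (RealSplitting.block (bettiRep A) Φ k)) ∧
        (∀ k, (RealPlaces.blockMat (RealSplitting.isInternal_block (bettiRep A) Φ) b' Y k).trace = 0) ∧
        (∀ k k', cls k = cls k' → RealPlaces.blockMat (RealSplitting.isInternal_block (bettiRep A) Φ) b' Y k =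
          RealPlaces.blockMat (RealSplitting.isInternal_block (bettiRep A) Φ) b' Y k')) :
    Module.finrank ℂ (BettiUniverse.hodge hHD (AbelianVariety.isSmoothProjective_holds (A := A)) 1).hodgeLieC =
      3 * Fintype.card ι := by
  set H := BettiUniverse.hodge hHD (AbelianVariety.isSmoothProjective_holds (A := A)) 1 with hH
  set hint := RealSplitting.isInternal_block (bettiRep A) Φ with hhint
  have hB1 : ∀ {k k' : ι × Fin 2}, cls k = cls k' → k.1 = k'.1 := fun h => fst_eq_of_cls_eq Φ hHD hI hiff h
  have hB2 : ∀ i, cls (i, 0) = cls (i, 1) := cls_eq_of_fst_eq Φ hHD hI hiff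
  set tr : (ι → Matrix (Fin 2) (Fin 2) ℂ) →ₗ[ℂ] (ι → ℂ) :=
    LinearMap.pi fun k : ι => (Matrix.traceLinearMap (Fin 2) ℂ ℂ).comp (LinearMap.proj k) with htr
  have htr_apply : ∀ M k, tr M k = (M k).trace := fun M k => rfl
  -- the assembled operator of a trace-free family indexed by `ι` is in `Lie Hg ⊗ ℂ`
  have hmem : ∀ M : LinearMap.ker tr,
      RealPlaces.assemble hint b' (fun k : ι × Fin 2 => (M : ι → Matrix (Fin 2) (Fin 2) ℂ) k.1) ∈ H.hodgeLieC := by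
    intro M
    have hM := M.2
    rw [LinearMap.mem_ker] at hM
    set F : ι × Fin 2 → Matrix (Fin 2) (Fin 2) ℂ := fun k => (M : ι → Matrix (Fin 2) (Fin 2) ℂ) k.1 with hF
    have hYF : RealPlaces.blockMat hint b' (RealPlaces.assemble hint b' F) = F := RealPlaces.blockMat_assemble hint b' F
    refine (hiff _).2 ⟨fun k => RealPlaces.assemble_mapsTo hint b' F k, fun k => ?_, fun k k' hkk' => ?_⟩
    · rw [hYF, hF]
      have h := congrFun hM k.1
      rwa [htr_apply, Pi.zero_apply] at h
    · rw [hYF, hF]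
      dsimp only
      rw [hB1 hkk']
  -- the blocks at `(i,1)` repeat the blocks at `(i,0)`
  have hrep : ∀ Y ∈ H.hodgeLieC, (fun k : ι × Fin 2 => RealPlaces.blockMat hint b' Y (k.1, 0)) =
      RealPlaces.blockMat hint b' Y := by
    intro Y hY
    obtain ⟨-, -, hcls⟩ := (hiff _).1 hY
    funext k
    obtain ⟨i, j⟩ := k
    fin_cases j
    · rfl
    · exact hcls _ _ (hB2 i)
  -- the extractor `Y ↦ (blockMat Y (i,0))_i` is a linear bijection `Lie Hg ⊗ ℂ ≃ trace-free families`
  have e : H.hodgeLieC ≃ₗ[ℂ] LinearMap.ker tr :=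
    { toFun := fun Y => ⟨fun i => RealPlaces.blockMat hint b' (Y : Module.End ℂ (ℂ ⊗[ℚ] bettiCohomology A.X 1)) (i, 0), by
        rw [LinearMap.mem_ker]
        funext i
        rw [htr_apply, Pi.zero_apply]
        exact ((hiff _).1 Y.2).2.1 (i, 0)⟩
      map_add' := fun Y Y' => by
        refine Subtype.ext (funext fun i => ?_)
        simp only [Submodule.coe_add, map_add, Pi.add_apply]
      map_smul' := fun c Y => by
        refine Subtype.ext (funext fun i => ?_)
        simp only [Submodule.coe_smul, map_smul, Pi.smul_apply, RingHom.id_apply]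
      invFun := fun M => ⟨RealPlaces.assemble hint b' (fun k : ι × Fin 2 => (M : ι → Matrix (Fin 2) (Fin 2) ℂ) k.1), hmem M⟩
      left_inv := fun Y => by
        refine Subtype.ext ?_
        change RealPlaces.assemble hint b'
            (fun k : ι × Fin 2 => RealPlaces.blockMat hint b' (Y : Module.End ℂ (ℂ ⊗[ℚ] bettiCohomology A.X 1)) (k.1, 0)) =
          (Y : Module.End ℂ (ℂ ⊗[ℚ] bettiCohomology A.X 1))
        rw [hrep _ Y.2, RealPlaces.assemble_blockMat hint b' ((hiff _).1 Y.2).1]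
      right_inv := fun M => by
        refine Subtype.ext (funext fun i => ?_)
        change RealPlaces.blockMat hint b'
            (RealPlaces.assemble hint b' (fun k : ι × Fin 2 => (M : ι → Matrix (Fin 2) (Fin 2) ℂ) k.1)) (i, 0) = _
        rw [RealPlaces.blockMat_assemble] }
  rw [e.finrank_eq, htr]
  exact finrank_traceFree_blocks ℂ ι

end Classes

/-! ### §2 The rank: `dim Lie Hg(H¹A) = 3|ι|`, `dim MT(H¹A) = 3|ι| + 1` -/

/-- **`dim_ℂ Lie Hg(A) ⊗ ℂ = 3|ι|` for a simple `A` with a real splitting `ℝ ⊗ End⁰(A) ≅ ∏_ι M₂(ℝ)` and `dim A = 2|ι|`**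
(Moonen–Zarhin (2.2) «`Hg = U_{D^opp}`»; B–G–K (7.22) `H(A) = L(A) = C_D(Sp(V,ψ))`, of dimension `3e`).
[cite: MoonenZarhin1999LowDim, (2.2)] [cite: BanaszakGajdaKrason2006, (7.22)] [cite: Murty1988, Thm. 2 (p. 67)] -/
theorem finrank_hodgeLieC_hodge_one_of_isSimple_realSplitting [HodgeTensorFacts.{0, 0}] (hA : A.IsSimple)
    (Φ : ℝ ⊗[ℚ] A.endAlgebra ≃ₐ[ℝ] (ι → Matrix (Fin 2) (Fin 2) ℝ)) (hdim : A.dim = 2 * Fintype.card ι)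
    (hHD : exists_isReal_hodgeModel) (hI : hodgePQ_independent_of_hodgeModel) :
    Module.finrank ℂ (BettiUniverse.hodge hHD (AbelianVariety.isSmoothProjective_holds (A := A)) 1).hodgeLieC =
      3 * Fintype.card ι := by
  obtain ⟨cls, b', -, -, -, hiff⟩ := exists_mem_hodgeLieC_iff_of_realSplitting hA Φ hdim hHD hI
  exact finrank_hodgeLieC_of_glued Φ hHD hI hiff

/-- **`dim_ℚ Lie Hg(H¹A) = 3|ι|`** for a simple `A` with a real splitting `ℝ ⊗ End⁰(A) ≅ ∏_ι M₂(ℝ)` and `dim A = 2|ι|`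
(`dim_ℂ Lie Hg ⊗ ℂ = dim_ℚ Lie Hg`; Hazama's «`𝔥 = 𝔰𝔩₂ × ⋯ × 𝔰𝔩₂`», one `𝔰𝔩₂` per factor).
[cite: MoonenZarhin1999LowDim, (2.2)] [cite: BanaszakGajdaKrason2006, (7.22)] [cite: Hazama1983, §3 (p. 306)] -/
theorem finrank_hodgeLie_hodge_one_of_isSimple_realSplitting [HodgeTensorFacts.{0, 0}] (hA : A.IsSimple)
    (Φ : ℝ ⊗[ℚ] A.endAlgebra ≃ₐ[ℝ] (ι → Matrix (Fin 2) (Fin 2) ℝ)) (hdim : A.dim = 2 * Fintype.card ι)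
    (hHD : exists_isReal_hodgeModel) (hI : hodgePQ_independent_of_hodgeModel) :
    haveI := finite_bettiCohomology_one A
    Module.finrank ℚ (BettiUniverse.hodge hHD (AbelianVariety.isSmoothProjective_holds (A := A)) 1).hodgeLie =
      3 * Fintype.card ι := by
  haveI := finite_bettiCohomology_one A
  rw [← finrank_hodgeLieC, finrank_hodgeLieC_hodge_one_of_isSimple_realSplitting hA Φ hdim hHD hI]

/-- **`dim MT(H¹A) = 3|ι| + 1`** for a simple `A` with a real splitting `ℝ ⊗ End⁰(A) ≅ ∏_ι M₂(ℝ)`, `ι` non-empty, and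
`dim A = 2|ι|` (the tree's `dim MT = dim Lie Hg + 1`). [cite: MoonenZarhin1999LowDim, (2.2)] [cite: BanaszakGajdaKrason2006, (7.22)] -/
theorem mtRank_hodge_one_of_isSimple_realSplitting [HodgeTensorFacts.{0, 0}] [Nonempty ι] (hA : A.IsSimple)
    (Φ : ℝ ⊗[ℚ] A.endAlgebra ≃ₐ[ℝ] (ι → Matrix (Fin 2) (Fin 2) ℝ)) (hdim : A.dim = 2 * Fintype.card ι)
    (hHD : exists_isReal_hodgeModel) (hI : hodgePQ_independent_of_hodgeModel) :
    haveI := finite_bettiCohomology_one A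
    (BettiUniverse.hodge hHD (AbelianVariety.isSmoothProjective_holds (A := A)) 1).mtRank = 3 * Fintype.card ι + 1 := by
  classical
  haveI := finite_bettiCohomology_one A
  haveI : Nontrivial (bettiCohomology A.X 1) := by
    apply Module.nontrivial_of_finrank_pos (R := ℚ)
    rw [finrank_bettiCohomology_one, hdim]
    have := Fintype.card_pos (α := ι)
    omega
  obtain ⟨ψ⟩ := BettiUniverse.hodge_isPolarizable hHD (AbelianVariety.isSmoothProjective_holds (A := A)) 1
  rw [mtRank_eq_finrank_hodgeLie_add_one _ ψ (by norm_num), finrank_hodgeLie_hodge_one_of_isSimple_realSplitting hA Φ hdim hHD hI]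

/-! ### §3 The Albert form: `End⁰(A)` a totally indefinite quaternion algebra over a totally real field, `dim A = 2[K:ℚ]` -/

section Albert

variable {K : Type} [Field K] [NumberField K] [IsTotallyReal K] [Algebra K A.endAlgebra] [IsScalarTower ℚ K A.endAlgebra]
  [IsQuaternionAlgebra K A.endAlgebra]

/-- **Type II minimal: `dim_ℚ Lie Hg(H¹A) = 3[K:ℚ]`** for a simple complex abelian variety `A` whose endomorphism algebra
is a quaternion algebra over a totally real number field `K`, split at every infinite place, with `dim A = 2[K:ℚ]`
(Moonen–Zarhin (2.2); B–G–K (7.22) `H(A) = L(A)`; Murty Thm. 2, `m = 1`) — §2 at the real splitting indexed by the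
`[K:ℚ]` infinite places of `K`. [cite: MoonenZarhin1999LowDim, (2.2)] [cite: BanaszakGajdaKrason2006, (7.22) and Thm. 7.34]
[cite: Murty1988, Thm. 2 (p. 67)] [cite: MumfordAV1970, §21 Thm. 2 (type II)] -/
theorem finrank_hodgeLie_hodge_one_of_isSimple_isTotallyIndefinite [HodgeTensorFacts.{0, 0}] (hA : A.IsSimple)
    (hind : IsTotallyIndefinite K A.endAlgebra) (hdim : A.dim = 2 * Module.finrank ℚ K)
    (hHD : exists_isReal_hodgeModel) (hI : hodgePQ_independent_of_hodgeModel) :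
    haveI := finite_bettiCohomology_one A
    Module.finrank ℚ (BettiUniverse.hodge hHD (AbelianVariety.isSmoothProjective_holds (A := A)) 1).hodgeLie =
      3 * Module.finrank ℚ K := by
  classical
  obtain ⟨Φ⟩ := nonempty_realSplitting_of_isSimple_isTotallyIndefinite hA hind
  rw [← card_infinitePlace_eq_finrank_of_isTotallyReal K] at hdim ⊢
  exact finrank_hodgeLie_hodge_one_of_isSimple_realSplitting hA Φ hdim hHD hI

/-- **Type II minimal: `dim MT(H¹A) = 3[K:ℚ] + 1`** under the same hypotheses (`MT = 𝔾_m · Hg`).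
[cite: MoonenZarhin1999LowDim, (2.2)] [cite: BanaszakGajdaKrason2006, (7.22) and Thm. 7.34] [cite: Murty1988, Thm. 2 (p. 67)] -/
theorem mtRank_hodge_one_of_isSimple_isTotallyIndefinite [HodgeTensorFacts.{0, 0}] (hA : A.IsSimple)
    (hind : IsTotallyIndefinite K A.endAlgebra) (hdim : A.dim = 2 * Module.finrank ℚ K)
    (hHD : exists_isReal_hodgeModel) (hI : hodgePQ_independent_of_hodgeModel) :
    haveI := finite_bettiCohomology_one A
    (BettiUniverse.hodge hHD (AbelianVariety.isSmoothProjective_holds (A := A)) 1).mtRank = 3 * Module.finrank ℚ K + 1 := by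
  classical
  obtain ⟨Φ⟩ := nonempty_realSplitting_of_isSimple_isTotallyIndefinite hA hind
  haveI : Nonempty (InfinitePlace K) := inferInstance
  rw [← card_infinitePlace_eq_finrank_of_isTotallyReal K] at hdim ⊢
  exact mtRank_hodge_one_of_isSimple_realSplitting hA Φ hdim hHD hI

/-- The same with an arbitrary smooth-projective witness `hX : IsSmoothProjective n A.X` and the tree's model
`exists_isReal_hodgeModel_holds` (the form used on the Mumford–Tate rank ladder `CorCM/MumfordTateRank*`): for `A` simple
with `End⁰(A)` a totally indefinite quaternion algebra over a totally real `K` and `dim A = 2[K:ℚ]`,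
`dim MT(H¹A) = 3[K:ℚ] + 1` and `dim Lie Hg(H¹A) = 3[K:ℚ]`. [cite: MoonenZarhin1999LowDim, (2.2)]
[cite: BanaszakGajdaKrason2006, (7.22) and Thm. 7.34] [cite: Murty1988, Thm. 2 (p. 67)] -/
theorem mtRank_hodge_one_of_isSimple_isTotallyIndefinite' [HodgeTensorFacts.{0, 0}] {n : ℕ} (hX : IsSmoothProjective n A.X)
    (hA : A.IsSimple) (hind : IsTotallyIndefinite K A.endAlgebra) (hdim : A.dim = 2 * Module.finrank ℚ K) :
    haveI := BettiUniverse.finite hX 1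
    (BettiUniverse.hodge exists_isReal_hodgeModel_holds hX 1).mtRank = 3 * Module.finrank ℚ K + 1 ∧
      Module.finrank ℚ (BettiUniverse.hodge exists_isReal_hodgeModel_holds hX 1).hodgeLie = 3 * Module.finrank ℚ K := by
  have hn : A.dim = n := schemeDim_eq_holds hX
  subst hn
  haveI := BettiUniverse.finite hX 1
  exact ⟨mtRank_hodge_one_of_isSimple_isTotallyIndefinite hA hind hdim exists_isReal_hodgeModel_holds
      hodgePQ_independent_of_hodgeModel_holds,
    finrank_hodgeLie_hodge_one_of_isSimple_isTotallyIndefinite hA hind hdim exists_isReal_hodgeModel_holds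
      hodgePQ_independent_of_hodgeModel_holds⟩

end Albert

end Literature.AlgebraicGeometry.HodgeTheory

end
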